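import Literature.Computability.Cryptography.KitaevFamilyUniform
import Literature.Computability.Cryptography.OrderFindingPostFP
import Literature.Computability.QuantumComplexity.CWrapAssembly
import HarnessLib

/-!
# Shor's order-finding theorem (`Shor1997_orderFinding_isQSolvable` discharged)

Family `PQC` (trunk `CryptoQuantFine`); closes the chain of companions of
`Literature/Computability/Cryptography/ShorProofs.lean` for the named fact
`Literature.Computability.Cryptography.Shor1997_orderFinding_isQSolvable` (Shor 1997, §5, pp. 13–15
of arXiv:quant-ph/9508027v2: "we give a quantum computer algorithm for finding the order of an
element `x` in the multiplicative group `(mod n)`; that is, the least integer `r` such that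
`x^r ≡ 1 (mod n)`" … "we find `r` at least a `δ / log log r` fraction of the time, so by repeating
this experiment only `O(log log r)` times, we are assured of a high probability of success").
Over the tree's model (poly-time uniform oracle-free Clifford+T families measured on all wires,
`IsQSolvable`) Shor's transform `A_q` is not an exact `{H, S, T, CNOT}` circuit, so the exact
route formalised in the tree is Kitaev's (1995, §3): Hadamard tests of the controlled powers
`U^{2^l}` of multiplication by `x`, Chebyshev per block, quadrant refinement, the nearest fraction
with denominator `< n` (Shor's continued-fraction step) and the `lcm` of four trials
(`ShorOrderFindingQuantum.lean`, whose assembly theorem `Shor1997_orderFinding_isQSolvable_of`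
takes three named infrastructure facts). All three are theorems of the tree:

* `isQSolvable_classicalWrap_holds` — classical pre- and post-processing inside bounded-error
  quantum search (`QuantumComplexity/CWrapAssembly.lean`; Bernstein–Vazirani 1997, §8);
* `Kitaev1995_orderFindingFamily_holds` — the uniform Kitaev family around the clean reversible
  modular-exponentiation block (`ShorModExpBlock.lean`, `KitaevFamilyUniform.lean`; Shor 1997, §3
  and §2 p. 7; Kitaev 1995, §2.2 Lemma 1, §4 p. 15);
* `orderFindingPost_mem_FP_holds` — the classical post-processor is polynomial time
  (`OrderFindingPostFP.lean`; Shor 1997, §5 p. 14 "this fraction can be found in polynomial time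
  by using a continued fraction expansion"; Kitaev 1995, §3 Thm. 1).

This file is the order-finding twin of `ShorDiscreteLogTheorem.lean` (`isQSolvable_dlog_holds`);
it cannot live in `ShorProofs.lean` itself, which all three discharging files import.

## References

* P. W. Shor, *Polynomial-time algorithms for prime factorization and discrete logarithms on a
  quantum computer*, SIAM J. Comput. 26 (1997) 1484–1509 (= arXiv:quant-ph/9508027v2), §5
  (pp. 13–15: quantum order finding; success `≥ δ / log log r` per run, `O(log log r)` repetitions).
* A. Yu. Kitaev, *Quantum measurements and the Abelian Stabilizer Problem*,
  arXiv:quant-ph/9511026 (1995), §2.2 Lemma 1, §3 (Lemma 10, Thm. 1), §4 (p. 15).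
* E. Bernstein, U. Vazirani, *Quantum complexity theory*, SIAM J. Comput. 26 (1997), §8.
-/

noncomputable section

namespace Literature.Computability.Cryptography

/-- **Shor's order-finding theorem** (Shor 1997, §5): the order of a unit `x` modulo `n` — the
least `r > 0` with `x ^ r ≡ 1 (mod n)` — is computable in bounded-error quantum polynomial time,
in the tree's FBQP form `Shor1997_orderFinding_isQSolvable` (`ShorProofs.lean`: some poly-time
uniform, oracle-free Clifford+T family, run on the encoding of `(x, n)` with `1 < n`,
`gcd(x, n) = 1` and measured on all wires, outputs with probability `≥ 2/3` a string with prefix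
the binary encoding of `orderOf (x : ZMod n)`). Unconditional: `Shor1997_orderFinding_isQSolvable_of`
(`ShorOrderFindingQuantum.lean`, Kitaev's exact Clifford+T route with success `≥ 77/96`) fed with
the three discharged infrastructure facts `isQSolvable_classicalWrap_holds`,
`Kitaev1995_orderFindingFamily_holds`, `orderFindingPost_mem_FP_holds`.
[cite: Shor1997SICOMP, §5 pp. 13–15 of arXiv v2 (quantum algorithm for order finding); Kitaev1995, §3 Thm 1 and §4] -/
theorem Shor1997_orderFinding_isQSolvable_holds : Shor1997_orderFinding_isQSolvable :=
  Shor1997_orderFinding_isQSolvable_of isQSolvable_classicalWrap_holds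
    Kitaev1995_orderFindingFamily_holds orderFindingPost_mem_FP_holds

end Literature.Computability.Cryptography

end
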